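import Summits.CriticalPhenomena.SAWScalingLimit.Theorems.BoundaryTP2Negative_Annulus
import Mathlib.NumberTheory.Real.Irrational
import Mathlib.Topology.Baire.Lemmas
import Mathlib.Topology.Baire.CompleteMetrizable

/-!
# Every finite connected induced subgraph of `ℤ²` is the discrete domain of a bounded, open,
# star-convex (hence simply connected) planar set

Route `SAWTotalPositivity`, item stmt-CriticalPhenomena-7120 (`BoundaryHarnack`) — realisation
toolkit for the corridor gadget (`BoundaryHarnack ⇒` uniform critical half-plane arch bound), and the
closed form of the refuters' typing caveat "`SimplyConnectedSpace Ω` does not constrain `Ω_δ`"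
(cf. `BoundaryTP2Negative_Annulus.lean`, which does the 8-cycle).

Construction (mesh `δ = 1`). Let `V ⊆ boxSites a b`. Take the open rectangle `openBox a b`
(`= siteDomain (boxSites a b)`), the centre `c⋆ = (a₀ + 1/4) + i (a₁ + √2 - 1) ∈ openBox a b`, and
remove, for every lattice point `d` of the box NOT in `V`, the closed radial tail
`tail c⋆ d = {d + s (d - c⋆) : s ≥ 0}` (pointing away from `c⋆`):

  `realise a b V = openBox a b \ ⋃_{d ∈ boxSites a b \ V} tail c⋆ d`.

* Tails point away from the centre, so `realise a b V` is star-convex (`starConvex_diff_tail`), hence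
  contractible and simply connected; it is bounded.
* `Re c⋆ ∈ ℚ \ ℤ… ` precisely `Re c⋆ = a₀ + 1/4`, `Im c⋆ = a₁ + √2 - 1 ∉ ℚ`: a line through `c⋆`
  contains at most one lattice point (`eq_of_toComplex_mem_tail`), so the mesh vertices are exactly
  `V` (`meshVertices_realise`).
* Tails lie on lines, whose complements are open and dense, so `openBox a b ⊆ closure (realise a b V)`
  and every lattice edge between sites of `V` survives (`meshGraph_realise_adj`): the mesh graph on
  `V` is `ℤ²` INDUCED on `V`.
* If `V` is connected through lattice steps, the discrete domain is `V` and
  `discreteDomainGraph (realise a b V) 1` is `ℤ²[V]` (`adj_realise_iff`).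

Consequently holes, width-one corridors, notches and mazes are all admissible discrete domains of
the items `BoundaryTP2` / `BoundaryHarnack` / `CriticalBubbleBound` (`exists_domain_of_connected`).
Everything proved. [folklore]
-/

noncomputable section

namespace Summit.CriticalPhenomena.SAWScalingLimit.Theorems.BoundaryHarnack.Realisation

open Literature.Probability.LatticeModels Complex Set Metric
open Summit.CriticalPhenomena.SAWScalingLimit.Theorems.BoundaryTP2.Negative
  (tail starConvex_diff_tail openBox convex_openBox siteDomain_boxSites)

variable {a b : Site 2} {V : Set (Site 2)}

/-! ### The generic star centre -/

/-- The star centre `c⋆ = (a₀ + 1/4) + i (a₁ + √2 - 1)`: rational non-integral real part,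
irrational imaginary part. [folklore] -/
def centre (a : Site 2) : ℂ := ⟨(a 0 : ℝ) + 1 / 4, (a 1 : ℝ) + (Real.sqrt 2 - 1)⟩

/-- Real part of the centre. [folklore] -/
@[simp] theorem centre_re (a : Site 2) : (centre a).re = (a 0 : ℝ) + 1 / 4 := rfl

/-- Imaginary part of the centre. [folklore] -/
@[simp] theorem centre_im (a : Site 2) : (centre a).im = (a 1 : ℝ) + (Real.sqrt 2 - 1) := rfl

/-- `1 < √2 < 3/2`. [folklore] -/
theorem one_lt_sqrt_two_and_lt : 1 < Real.sqrt 2 ∧ Real.sqrt 2 < 3 / 2 := by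
  constructor
  · rw [show (1 : ℝ) = Real.sqrt 1 by simp]
    exact Real.sqrt_lt_sqrt (by norm_num) (by norm_num)
  · rw [Real.sqrt_lt' (by norm_num)]
    norm_num

/-- The centre lies in the open rectangle of a nonempty box. [folklore] -/
theorem centre_mem_openBox (hab : ∀ i, a i ≤ b i) : centre a ∈ openBox a b := by
  have h0 : (a 0 : ℝ) ≤ b 0 := by exact_mod_cast hab 0
  have h1 : (a 1 : ℝ) ≤ b 1 := by exact_mod_cast hab 1
  have hs := one_lt_sqrt_two_and_lt
  simp only [openBox, mem_setOf_eq, centre_re, centre_im]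
  refine ⟨⟨by linarith, by linarith⟩, by linarith, by linarith⟩

/-- A lattice point is not the centre (its real part is not an integer). [folklore] -/
theorem toComplex_ne_centre (d : Site 2) : Site.toComplex d ≠ centre a := by
  intro h
  have hre := congrArg Complex.re h
  simp only [Site.toComplex_re, centre_re] at hre
  have h4 : (4 : ℝ) * d 0 = 4 * a 0 + 1 := by linarith
  have h4' : (4 : ℤ) * d 0 = 4 * a 0 + 1 := by exact_mod_cast h4
  omega

/-- **Genericity of the centre**: a lattice point `v` lying on the tail of a lattice point `d`
(the closed ray from `d` away from `c⋆`) is `d` itself — a line through `c⋆` contains at most one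
lattice point, because `Re c⋆` is rational and non-integral while `Im c⋆` is irrational. [folklore] -/
theorem eq_of_toComplex_mem_tail {d v : Site 2}
    (h : Site.toComplex v ∈ tail (centre a) (Site.toComplex d)) : v = d := by
  obtain ⟨t, ht, hvt⟩ := h
  have hre := congrArg Complex.re hvt
  have him := congrArg Complex.im hvt
  simp only [Site.toComplex_re, Site.toComplex_im, add_re, add_im, mul_re, mul_im, ofReal_re,
    ofReal_im, sub_re, sub_im, centre_re, centre_im, zero_mul, sub_zero, add_zero] at hre him
  -- hre : v0 = d0 + t (d0 - (a0 + 1/4)),  him : v1 = d1 + t (d1 - (a1 + (√2 - 1)))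
  by_cases h0 : v 0 = d 0
  · -- then `t (d0 - c_re) = 0`, and `d0 ≠ c_re`, so `t = 0` and `v1 = d1`
    have h0r : (v 0 : ℝ) = d 0 := by exact_mod_cast h0
    have hprod : t * ((d 0 : ℝ) - ((a 0 : ℝ) + 1 / 4)) = 0 := by linarith
    have hd : (d 0 : ℝ) - ((a 0 : ℝ) + 1 / 4) ≠ 0 := by
      intro hz
      have h4 : (4 : ℝ) * d 0 = 4 * a 0 + 1 := by linarith
      have h4' : (4 : ℤ) * d 0 = 4 * a 0 + 1 := by exact_mod_cast h4
      omega
    have ht0 : t = 0 := by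
      rcases mul_eq_zero.1 hprod with h | h
      · exact h
      · exact (hd h).elim
    rw [ht0] at him
    simp only [zero_mul, add_zero] at him
    have h1 : v 1 = d 1 := by exact_mod_cast him
    exact funext (Fin.forall_fin_two.2 ⟨h0, h1⟩)
  · -- cross-multiplying eliminates `t` and makes `√2` rational: contradiction
    exfalso
    have hcross : ((v 0 : ℝ) - d 0) * ((d 1 : ℝ) - ((a 1 : ℝ) + (Real.sqrt 2 - 1))) =
        ((v 1 : ℝ) - d 1) * ((d 0 : ℝ) - ((a 0 : ℝ) + 1 / 4)) := by
      have e0 : (v 0 : ℝ) - d 0 = t * ((d 0 : ℝ) - ((a 0 : ℝ) + 1 / 4)) := by linarith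
      have e1 : (v 1 : ℝ) - d 1 = t * ((d 1 : ℝ) - ((a 1 : ℝ) + (Real.sqrt 2 - 1))) := by linarith
      rw [e0, e1]; ring
    -- `√2 · 4 (v0 - d0) = z` with `z` an integer
    have hkey : Real.sqrt 2 * ((4 * (v 0 - d 0) : ℤ) : ℝ) =
        ((4 * (v 0 - d 0) * (d 1 - a 1 + 1) - (v 1 - d 1) * (4 * d 0 - 4 * a 0 - 1) : ℤ) : ℝ) := by
      push_cast
      linear_combination (-4) * hcross
    have hne : (4 * (v 0 - d 0) : ℤ) ≠ 0 := by omega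
    exact (irrational_sqrt_two.mul_intCast hne).ne_int _ hkey

/-- The centre is on no tail of a lattice point. [folklore] -/
theorem centre_not_mem_tail (d : Site 2) : centre a ∉ tail (centre a) (Site.toComplex d) := by
  rintro ⟨t, ht, h⟩
  -- `c = d + t (d - c)` forces `(1 + t) (c - d) = 0`
  have h' : ((1 : ℂ) + t) * (centre a - Site.toComplex d) = 0 := by linear_combination h
  rcases mul_eq_zero.1 h' with h1 | h1
  · have := congrArg Complex.re h1
    simp at this
    linarith
  · exact toComplex_ne_centre d (sub_eq_zero.1 h1).symm

/-! ### The realisation -/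

/-- **The realisation of `V ⊆ boxSites a b`**: the open rectangle minus the radial tails of the box
sites not in `V`. [folklore] -/
def realise (a b : Site 2) (V : Set (Site 2)) : Set ℂ :=
  openBox a b \ ⋃ d ∈ boxSites a b \ V, tail (centre a) (Site.toComplex d)

/-- Membership in the realisation, unfolded. [folklore] -/
theorem mem_realise_iff {z : ℂ} : z ∈ realise a b V ↔
    z ∈ openBox a b ∧ ∀ d ∈ boxSites a b \ V, z ∉ tail (centre a) (Site.toComplex d) := by
  simp only [realise, mem_sdiff, mem_iUnion, not_exists, exists_prop, not_and]

/-- The realisation is star-convex with respect to the centre. [folklore] -/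
theorem starConvex_realise (hab : ∀ i, a i ≤ b i) : StarConvex ℝ (centre a) (realise a b V) := by
  rw [starConvex_iff_segment_subset]
  intro z hz w hw
  rw [mem_realise_iff] at hz ⊢
  refine ⟨(convex_openBox a b).segment_subset (centre_mem_openBox hab) hz.1 hw, fun d hd hwd => ?_⟩
  have hst : StarConvex ℝ (centre a) (openBox a b \ tail (centre a) (Site.toComplex d)) :=
    starConvex_diff_tail ((convex_openBox a b).starConvex (centre_mem_openBox hab))
      (toComplex_ne_centre d)
  rw [starConvex_iff_segment_subset] at hst
  exact (hst ⟨hz.1, hz.2 d hd⟩ hw).2 hwd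

/-- The centre lies in the realisation. [folklore] -/
theorem centre_mem_realise (hab : ∀ i, a i ≤ b i) : centre a ∈ realise a b V :=
  mem_realise_iff.2 ⟨centre_mem_openBox hab, fun d _ => centre_not_mem_tail d⟩

/-- **The realisation is simply connected** (star-convex, hence contractible). [folklore] -/
theorem simplyConnectedSpace_realise (hab : ∀ i, a i ≤ b i) :
    SimplyConnectedSpace (realise a b V) := by
  haveI := (starConvex_realise (V := V) hab).contractibleSpace ⟨_, centre_mem_realise hab⟩
  infer_instance

/-- The realisation is bounded. [folklore] -/
theorem isBounded_realise : Bornology.IsBounded (realise a b V) :=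
  ((isBounded_siteDomain (boxSites_finite a b)).subset
    (by rw [siteDomain_boxSites]; exact fun z hz => hz.1))

/-! ### Mesh vertices: exactly `V` -/

/-- **The mesh vertices of the realisation are exactly `V`** (for `V` inside the box). [folklore] -/
theorem meshVertices_realise (hV : V ⊆ boxSites a b) : meshVertices (realise a b V) 1 = V := by
  ext x
  rw [mem_meshVertices_iff, meshPoint_one, mem_realise_iff, ← siteDomain_boxSites,
    toComplex_mem_siteDomain_iff]
  constructor
  · rintro ⟨hx, ht⟩
    by_contra hxV
    exact ht x ⟨hx, hxV⟩ ⟨0, le_rfl, by simp⟩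
  · intro hx
    refine ⟨hV hx, fun d hd hxd => hd.2 ?_⟩
    rwa [← eq_of_toComplex_mem_tail hxd]

/-! ### Mesh edges: `ℤ²` induced on `V` (tails are nowhere dense) -/

/-- The line through `c` and `p`. [folklore] -/
def line (c p : ℂ) : Set ℂ := {z | (z - c).im * (p - c).re = (z - c).re * (p - c).im}

/-- A tail lies on the corresponding line. [folklore] -/
theorem tail_subset_line (c p : ℂ) : tail c p ⊆ line c p := by
  rintro z ⟨t, -, rfl⟩
  simp only [line, mem_setOf_eq, sub_im, add_im, mul_im, ofReal_re, ofReal_im,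
    zero_mul, add_zero, sub_re, add_re, mul_re, sub_zero]
  ring

/-- The complement of a line is open. [folklore] -/
theorem isOpen_compl_line (c p : ℂ) : IsOpen (line c p)ᶜ := by
  have : IsClosed (line c p) := isClosed_eq (by fun_prop) (by fun_prop)
  exact this.isOpen_compl

/-- The complement of a (genuine) line is dense. [folklore] -/
theorem dense_compl_line {c p : ℂ} (hpc : p ≠ c) : Dense (line c p)ᶜ := by
  rw [Metric.dense_iff]
  intro z r hr
  by_cases hz : z ∈ line c p
  · -- move off the line in the normal direction `i (p - c)`
    have hn : 0 < Complex.normSq (p - c) := Complex.normSq_pos.2 (sub_ne_zero.2 hpc)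
    have hnorm : 0 < ‖p - c‖ := norm_pos_iff.2 (sub_ne_zero.2 hpc)
    set s : ℝ := r / (2 * ‖p - c‖) with hs
    have hs0 : 0 < s := div_pos hr (by positivity)
    refine ⟨z + (s : ℂ) * (Complex.I * (p - c)), ?_, ?_⟩
    · rw [Metric.mem_ball, dist_eq_norm, add_sub_cancel_left, norm_mul, norm_mul,
        Complex.norm_I, one_mul, Complex.norm_real, Real.norm_eq_abs, abs_of_pos hs0, hs,
        div_mul_eq_mul_div, div_lt_iff₀ (by positivity)]
      nlinarith
    · simp only [mem_compl_iff, line, mem_setOf_eq] at hz ⊢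
      intro h
      have key : ((z + (s : ℂ) * (Complex.I * (p - c))) - c).im * (p - c).re -
          ((z + (s : ℂ) * (Complex.I * (p - c))) - c).re * (p - c).im =
          ((z - c).im * (p - c).re - (z - c).re * (p - c).im) + s * Complex.normSq (p - c) := by
        simp only [sub_im, add_im, mul_im, ofReal_re, ofReal_im, Complex.I_re, Complex.I_im,
          zero_mul, add_zero, one_mul, zero_add, sub_re, add_re, mul_re, sub_zero, zero_sub,
          Complex.normSq_apply]
        ring
      have h1 : ((z + (s : ℂ) * (Complex.I * (p - c))) - c).im * (p - c).re -
          ((z + (s : ℂ) * (Complex.I * (p - c))) - c).re * (p - c).im = 0 := by rw [h]; ring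
      have h2 : (z - c).im * (p - c).re - (z - c).re * (p - c).im = 0 := by rw [hz]; ring
      rw [key, h2, zero_add] at h1
      have : 0 < s * Complex.normSq (p - c) := mul_pos hs0 hn
      linarith
  · exact ⟨z, Metric.mem_ball_self hr, hz⟩

/-- The complement of the union of the lines carrying the removed tails is dense (finitely many
lines). [folklore] -/
theorem dense_compl_lines (a b : Site 2) (V : Set (Site 2)) :
    Dense (⋂ d : ↥(boxSites a b \ V), (line (centre a) (Site.toComplex d.1))ᶜ) := by
  haveI : Countable ↥(boxSites a b \ V) :=
    (((boxSites_finite a b).subset sdiff_subset).countable).to_subtype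
  exact dense_iInter_of_isOpen (fun d => isOpen_compl_line _ _)
    (fun d => dense_compl_line (toComplex_ne_centre d.1))

/-- **The open rectangle lies in the closure of the realisation.** [folklore] -/
theorem openBox_subset_closure_realise : openBox a b ⊆ closure (realise a b V) := by
  have hopen : IsOpen (openBox a b) := by rw [← siteDomain_boxSites]; exact isOpen_siteDomain _
  refine ((dense_compl_lines a b V).open_subset_closure_inter hopen).trans (closure_mono ?_)
  rintro z ⟨hz, hl⟩
  rw [mem_realise_iff]
  refine ⟨hz, fun d hd hzd => ?_⟩
  rw [mem_iInter] at hl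
  exact hl ⟨d, hd⟩ (tail_subset_line _ _ hzd)

/-- **Neighbouring sites of `V` are joined in the mesh graph of the realisation** (the mesh graph
on `V` is `ℤ²` induced on `V`). [folklore] -/
theorem meshGraph_realise_adj (hV : V ⊆ boxSites a b) {x y : Site 2} (hx : x ∈ V) (hy : y ∈ V)
    (h : (zdGraph 2).Adj x y) : (meshGraph (realise a b V) 1).Adj x y := by
  refine meshGraph_adj_iff.2 ⟨h, ?_⟩
  rw [meshPoint_one, meshPoint_one]
  refine Subset.trans ?_ openBox_subset_closure_realise
  rw [← siteDomain_boxSites]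
  obtain ⟨i, hi | hi⟩ := (zdGraph_adj_iff x y).1 h
  · subst hi; exact segment_subset_siteDomain (hV hx) (hV hy)
  · subst hi; rw [segment_symm]; exact segment_subset_siteDomain (hV hy) (hV hx)

/-! ### The discrete domain of a connected `V` -/

/-- Lattice walks inside `V` give walks in the mesh vertex graph of the realisation. [folklore] -/
theorem reachable_realise (hV : V ⊆ boxSites a b) {x : Site 2}
    (hx : x ∈ meshVertices (realise a b V) 1) {y : Site 2}
    (h : Relation.ReflTransGen (SiteStep V) x y) (hy : y ∈ meshVertices (realise a b V) 1) :
    (meshVertexGraph (realise a b V) 1).Reachable ⟨x, hx⟩ ⟨y, hy⟩ := by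
  induction h with
  | refl => exact SimpleGraph.Reachable.refl _
  | @tail u w _ huw ih =>
    have hu : u ∈ meshVertices (realise a b V) 1 := by
      rw [meshVertices_realise hV]; exact huw.2.1
    refine (ih hu).trans (SimpleGraph.Adj.reachable ?_)
    exact SimpleGraph.induce_adj.2 (meshGraph_realise_adj hV huw.2.1 huw.2.2 huw.1)

/-- For lattice-connected `V`, the mesh vertex graph of the realisation is preconnected. [folklore] -/
theorem preconnected_realise (hV : V ⊆ boxSites a b)
    (hconn : ∀ x ∈ V, ∀ y ∈ V, Relation.ReflTransGen (SiteStep V) x y) :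
    (meshVertexGraph (realise a b V) 1).Preconnected := by
  intro u w
  have hu : u.1 ∈ V := (meshVertices_realise hV).subset u.2
  have hw : w.1 ∈ V := (meshVertices_realise hV).subset w.2
  exact reachable_realise hV u.2 (hconn u.1 hu w.1 hw) w.2

/-- **For lattice-connected `V`, the discrete domain of the realisation is `V`.** [folklore] -/
theorem meshDomain_realise (hV : V ⊆ boxSites a b)
    (hconn : ∀ x ∈ V, ∀ y ∈ V, Relation.ReflTransGen (SiteStep V) x y) :
    meshDomain (realise a b V) 1 = V := by
  refine Subset.antisymm
    ((meshDomain_subset_meshVertices _ _).trans (meshVertices_realise hV).subset) fun v hv => ?_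
  have hv' : v ∈ meshVertices (realise a b V) 1 := by rw [meshVertices_realise hV]; exact hv
  have hsub := (preconnected_realise hV hconn).subsingleton_connectedComponent
  simp only [meshDomain, mem_iUnion, mem_image]
  refine ⟨(meshVertexGraph (realise a b V) 1).connectedComponentMk ⟨v, hv'⟩, fun C' => ?_,
    ⟨v, hv'⟩, ?_, rfl⟩
  · rw [Subsingleton.elim C' ((meshVertexGraph (realise a b V) 1).connectedComponentMk ⟨v, hv'⟩)]
  · rw [SimpleGraph.ConnectedComponent.mem_supp_iff]

/-- **The domain graph of the realisation of a lattice-connected `V` is `ℤ²` induced on `V`.**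
[folklore] -/
theorem adj_realise_iff (hV : V ⊆ boxSites a b)
    (hconn : ∀ x ∈ V, ∀ y ∈ V, Relation.ReflTransGen (SiteStep V) x y) {x y : Site 2} :
    (discreteDomainGraph (realise a b V) 1).Adj x y ↔ (zdGraph 2).Adj x y ∧ x ∈ V ∧ y ∈ V := by
  rw [discreteDomainGraph_adj_iff, meshDomain_realise hV hconn]
  constructor
  · rintro ⟨h, hx, hy⟩
    exact ⟨meshGraph_le_zdGraph _ _ h, hx, hy⟩
  · rintro ⟨h, hx, hy⟩
    exact ⟨meshGraph_realise_adj hV hx hy h, hx, hy⟩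

/-- **Every lattice-connected set of sites inside a nonempty box is the discrete domain (at mesh
`1`) of a bounded, simply connected `Ω ⊆ ℂ`, with `Ω_1 = ℤ²[V]`.** In particular the hypotheses
`IsBounded Ω`, `SimplyConnectedSpace Ω` of `BoundaryTP2` / `BoundaryHarnack` allow holes,
width-one corridors and notches in `Ω_δ`. [folklore] -/
theorem exists_domain_of_connected (hab : ∀ i, a i ≤ b i) (hV : V ⊆ boxSites a b)
    (hconn : ∀ x ∈ V, ∀ y ∈ V, Relation.ReflTransGen (SiteStep V) x y) :
    ∃ Ω : Set ℂ, Bornology.IsBounded Ω ∧ SimplyConnectedSpace Ω ∧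
      ∀ x y : Site 2, (discreteDomainGraph Ω 1).Adj x y ↔ (zdGraph 2).Adj x y ∧ x ∈ V ∧ y ∈ V :=
  ⟨realise a b V, isBounded_realise, simplyConnectedSpace_realise hab,
    fun _ _ => adj_realise_iff hV hconn⟩

end Summit.CriticalPhenomena.SAWScalingLimit.Theorems.BoundaryHarnack.Realisation
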